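import Summits.BirchSwinnertonDyer.Rank1Residual.SecondDescent.BSDpFromSecondDescentNonempty
import Summits.BirchSwinnertonDyer.Rank1Residual.Additive.X4RankZeroKatoBound
import HarnessLib

/-!
# `BSD(E,3)` on X4 (additive at 3, potentially good, big image), analytic rank 0, `ord₃ #Ш_an ≤ 4`, from TWO second-3-descent `NONEMPTY` witnesses + Kato's upper half (cell `b2b-bsdres`, CLASS-CLOSURE instrument seat cc-eng-4, GEN 6)

HONEST FRAMING (run/shared/lean/b2b/bsd-rank1-residual/, verbatim in every file): the goal of the
cell is to DELETE the COMBINATION-SHAPED residual classes of the Birch–Swinnerton-Dyer formula for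
ALL analytic-rank `≤ 1` elliptic curves over `ℚ` — "full BSD formula for every rank `≤ 1` curve in
class `C`" assembled STRICTLY from published theorems — so that the rank-`≤ 1` remainder becomes
exactly the CONSTRUCTION-SHAPED classes, which are TYPED (missing-input `Prop`s), NOT attempted.
This is not "finishing BSD". Class X4 stays CONSTRUCTION-SHAPED; the theorems below are PER-PAIR
certificate consumers; per-curve second-descent outputs are INSTRUMENTATION (E4) / EVIDENCE under
census-lead's label; nothing is booked here; no named fact is added.

Theorems only. **What this file proves.** The X4 twin of the X8 / X7 / X6 consumers of
`SecondDescent/BSDpFromSecondDescentNonempty.lean` (cc-eng-4 GEN 5, p289120 / p289561): on an X4 pair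
`(E, 3)` of analytic rank `0` with `ord₃ j ≥ 0` (potentially good), `ρ̄_{E,3^n}` onto for every `n`,
`3 ∤ ∏ c_ℓ`, a parametrisation datum with `3 ∤ c_D`, and `ord₃ #Ш_an ≤ 4`, the B-1 instrument's
`NONEMPTY × 2` reading — `#Ш(E)[3] = 9` and two `3`-torsion classes `c₁, c₂` spanning `Ш[3]` that are
BOTH third multiples in `Ш` (Creutz 2014: the `3`-Selmer SET of the corresponding plane cubic is
non-empty ⟺ the class lifts to `Sel^(9)`) — gives `3⁴ ∣ #Ш`
(`WeierstrassCurve.pow_four_dvd_card_sha_of_two_divisible`, p288532), hence the typed LOWER half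
by Cassels–Tate parity (`missingLowerBoundAt_of_casselsTate_of_two_divisible`), and Kato 2004 Thm.
14.5 (3) + Prop. 14.16 (2) (`Additive.X4RankZero.bsdp_of_missingLowerBoundAt_of_kato`, additive-p4
line V20, named fact `Kato2004.rankZero_padicValNat_sha_le_of_additive_potGood_of_imageContainsSL2`,
referee D-audit flag `Kato-14.5(3)-14.16(2)-additive-potgood-reading` on record) supplies the UPPER
half: `BSD(E,3)`.
* `X4RankZero.bsdp_three_of_kato_of_casselsTate_of_two_nonempty` — tower-surjectivity form;
* `X4RankZero.bsdp_three_of_kato_of_surj9_of_casselsTate_of_two_nonempty` — `ρ̄_{E,9}` onto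
  (`forall_hasSurjectiveModNGaloisRep_three_pow_of_nine`);
* `X4RankZero.bsdp_three_of_kato_of_surj_of_ram_of_casselsTate_of_two_nonempty` — census shape
  surj(3) ∧ ram(3) (`hasSurjectiveModNGaloisRep_pow_of_hasMultiplicativeReductionAtPrime`).
EVIDENCE pointer (a target, not an input): the one sha-2-census RESISTANT T-full3 window row with
`#Ш_an = 81` at `p = 3`, `19215t1 = [0,0,1,-10107597,-12660392115]` (`N = 3²·5·7·61`, type I₀*,
`∏ c_ℓ = 2`, `dim Sel₃ = 2` EXACT by two implementations, Kim 2025 App. 8.1.1 / the cell's SURJ9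
lists), staged as `class-closure/eng-4/b1/production-staged-g6/bundles/front-B1W-19215t1-t3/`;
nothing run, nothing booked.

References: K. Kato, Astérisque 295 (2004), Thm. 14.5 (3), Prop. 14.16 (2) [Kato2004Asterisque];
B. Creutz, Math. Comp. 83 (2014), §§1, 7–8 [Creutz2014]; J. W. S. Cassels 1962
[Cassels1962ArithmeticIV]; J. H. Silverman, *AEC* X.4.14 [SilvermanAEC2009]; R. L. Miller, LMS JCM
14 (2011) §1 [Miller2011LMS]; Burungale–Skinner–Tian–Wan 2024 (sur)/(ram) [BurungaleSkinnerTianWan2024].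
-/

set_option autoImplicit false

noncomputable section

open scoped Classical

open WeierstrassCurve Literature.NumberTheory.EllipticCurves
  Literature.NumberTheory.EllipticCurves.ModularForms
  Literature.NumberTheory.EllipticCurves.Rank1Residual
  Literature.NumberTheory.EllipticCurves.Rank1Residual.Typed
  Summit.BirchSwinnertonDyer.Rank1Residual.Additive

namespace Summit.BirchSwinnertonDyer.Rank1Residual.SecondDescent

variable (W : WeierstrassCurve ℚ) [W.IsElliptic] [W.IsGloballyMinimal]

/-- **X4 ∩ {r_an = 0}, `p = 3` potentially good, `ρ̄_{E,3^n}` onto for all `n`, `3 ∤ ∏ c_ℓ · c_D`,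
`ord₃ #Ш_an ≤ 4`: `BSD(E,3)` from Kato's upper half + `#Ш[3] = 9` + TWO second-`3`-descent
`NONEMPTY` witnesses on an `𝔽₃`-basis of `Ш[3]`.** Lower half:
`missingLowerBoundAt_of_casselsTate_of_two_divisible` (p289120; `3⁴ ∣ #Ш` by p288532, parity by
Cassels–Tate `hCT`, finiteness by GZK `hGZK`); upper half and assembly:
`Additive.X4RankZero.bsdp_of_missingLowerBoundAt_of_kato` (`hKato`, `hmod`). Per pair; class X4
unchanged; nothing booked. [cite: Kato2004Asterisque, Thm. 14.5 (3) (p. 236)]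
[cite: SilvermanAEC2009, Thm. X.4.14] [cite: Creutz2014, §1] [cite: Miller2011LMS, §1 and Def. 1.1] -/
theorem X4RankZero.bsdp_three_of_kato_of_casselsTate_of_two_nonempty
    (hKato : Kato2004.rankZero_padicValNat_sha_le_of_additive_potGood_of_imageContainsSL2)
    (hGZK : rank_eq_analyticRank_of_analyticRank_le_one) (hmod : hasEntireLFunction_rat)
    (hCT : exists_casselsTate_pairing (K := ℚ))
    (hr : W.analyticRank = 0) (hX : ClassX4 W 3) (hpot : 0 ≤ padicValRat 3 W.j)
    (hsurj : ∀ n : ℕ, W.HasSurjectiveModNGaloisRep (3 ^ n : ℕ)) (htam : ¬ 3 ∣ W.tamagawaProduct)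
    {N : ℕ} [NeZero N] (D : ModularParametrizationData W N) (hc : ¬ (3 : ℤ) ∣ D.maninConstant)
    (hcard : Nat.card (AddSubgroup.torsionBy W.sha (3 : ℤ)) = 9)
    {c₁ c₂ d₁ d₂ : W.sha} (h1 : 3 • c₁ = 0) (h2 : 3 • c₂ = 0) (hc₁ : c₁ ≠ 0)
    (hind : c₂ ∉ AddSubgroup.zmultiples c₁) (hd₁ : 3 • d₁ = c₁) (hd₂ : 3 • d₂ = c₂)
    {q : ℚ} (hq : shaAn W = (q : ℂ)) (hv : padicValRat 3 q ≤ 4) : BSDp W 3 :=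
  haveI : Fact (Nat.Prime 3) := ⟨Nat.prime_three⟩
  X4RankZero.bsdp_of_missingLowerBoundAt_of_kato W 3 hKato hGZK hmod hr hX hpot hsurj htam D
    (by exact_mod_cast hc)
    (missingLowerBoundAt_of_casselsTate_of_two_divisible W 3 hCT hGZK (by rw [hr]; exact zero_le_one)
      (by rw [show ((3 : ℕ) : ℤ) = 3 by norm_num, hcard]; norm_num) h1 h2 hc₁ hind hd₁ hd₂ hq hv)

/-- **The same with `ρ̄_{E,9}` onto** (tower surjectivity from level `9`,
`forall_hasSurjectiveModNGaloisRep_three_pow_of_nine`) — the shape of the `#Ш_an = 81` X4 window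
row `19215t1` (SURJ9). Per pair; nothing booked. [cite: Kato2004Asterisque, Thm. 14.5 (3) (p. 236)]
[cite: SilvermanAEC2009, Thm. X.4.14] [cite: Creutz2014, §1] [cite: Miller2011LMS, §1 and Def. 1.1] -/
theorem X4RankZero.bsdp_three_of_kato_of_surj9_of_casselsTate_of_two_nonempty
    (hKato : Kato2004.rankZero_padicValNat_sha_le_of_additive_potGood_of_imageContainsSL2)
    (hGZK : rank_eq_analyticRank_of_analyticRank_le_one) (hmod : hasEntireLFunction_rat)
    (hCT : exists_casselsTate_pairing (K := ℚ))
    (hr : W.analyticRank = 0) (hX : ClassX4 W 3) (hpot : 0 ≤ padicValRat 3 W.j)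
    (h9 : W.HasSurjectiveModNGaloisRep 9) (htam : ¬ 3 ∣ W.tamagawaProduct)
    {N : ℕ} [NeZero N] (D : ModularParametrizationData W N) (hc : ¬ (3 : ℤ) ∣ D.maninConstant)
    (hcard : Nat.card (AddSubgroup.torsionBy W.sha (3 : ℤ)) = 9)
    {c₁ c₂ d₁ d₂ : W.sha} (h1 : 3 • c₁ = 0) (h2 : 3 • c₂ = 0) (hc₁ : c₁ ≠ 0)
    (hind : c₂ ∉ AddSubgroup.zmultiples c₁) (hd₁ : 3 • d₁ = c₁) (hd₂ : 3 • d₂ = c₂)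
    {q : ℚ} (hq : shaAn W = (q : ℂ)) (hv : padicValRat 3 q ≤ 4) : BSDp W 3 :=
  X4RankZero.bsdp_three_of_kato_of_casselsTate_of_two_nonempty W hKato hGZK hmod hCT hr hX hpot
    (WeierstrassCurve.forall_hasSurjectiveModNGaloisRep_three_pow_of_nine W h9) htam D hc hcard h1 h2
    hc₁ hind hd₁ hd₂ hq hv

/-- **The same in the census shape surj(3) ∧ ram(3)** (a multiplicative prime `ℓ ≠ 3` with
`3 ∤ v_ℓ(Δ_min)`: tower surjectivity by
`hasSurjectiveModNGaloisRep_pow_of_hasMultiplicativeReductionAtPrime`, Kato's (12.5.2)). Per pair;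
nothing booked. [cite: Kato2004Asterisque, Thm. 14.5 (3) (p. 236), (12.5.2) (p. 222)]
[cite: BurungaleSkinnerTianWan2024, Part II (sur), (ram) (p. 74)] [cite: SilvermanAEC2009, Thm. X.4.14]
[cite: Creutz2014, §1] [cite: Miller2011LMS, §1 and Def. 1.1] -/
theorem X4RankZero.bsdp_three_of_kato_of_surj_of_ram_of_casselsTate_of_two_nonempty
    (hKato : Kato2004.rankZero_padicValNat_sha_le_of_additive_potGood_of_imageContainsSL2)
    (hGZK : rank_eq_analyticRank_of_analyticRank_le_one) (hmod : hasEntireLFunction_rat)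
    (hCT : exists_casselsTate_pairing (K := ℚ))
    (hr : W.analyticRank = 0) (hX : ClassX4 W 3) (hpot : 0 ≤ padicValRat 3 W.j) (hs : Surj W 3)
    (hram : Ram W 3) (htam : ¬ 3 ∣ W.tamagawaProduct)
    {N : ℕ} [NeZero N] (D : ModularParametrizationData W N) (hc : ¬ (3 : ℤ) ∣ D.maninConstant)
    (hcard : Nat.card (AddSubgroup.torsionBy W.sha (3 : ℤ)) = 9)
    {c₁ c₂ d₁ d₂ : W.sha} (h1 : 3 • c₁ = 0) (h2 : 3 • c₂ = 0) (hc₁ : c₁ ≠ 0)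
    (hind : c₂ ∉ AddSubgroup.zmultiples c₁) (hd₁ : 3 • d₁ = c₁) (hd₂ : 3 • d₂ = c₂)
    {q : ℚ} (hq : shaAn W = (q : ℂ)) (hv : padicValRat 3 q ≤ 4) : BSDp W 3 :=
  haveI : Fact (Nat.Prime 3) := ⟨Nat.prime_three⟩
  X4RankZero.bsdp_three_of_kato_of_casselsTate_of_two_nonempty W hKato hGZK hmod hCT hr hX hpot
    (hasSurjectiveModNGaloisRep_pow_of_hasMultiplicativeReductionAtPrime W 3 hs hram) htam D hc hcard
    h1 h2 hc₁ hind hd₁ hd₂ hq hv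


/-! ## Appendix (cc-eng-4 GEN 11, 2026-08-21): `hcard`-FREE forms

The binder `hcard : #Ш[3] = 9` of the three theorems above is NOT needed: `3⁴ ∣ #Ш` follows from the
two witnesses alone (`SecondDescent.missingLowerBoundAt_of_casselsTate_of_two_divisible'`, GEN 11
appendix of `BSDpFromSecondDescentNonempty.lean`, resting on `pow_four_dvd_card_sha_of_two_divisible'`).
The primed theorems are the ones above with `hcard` DELETED and nothing else changed. Consequence
for the X4 `#Ш_an = 81` row `19215t1`: its record needs no EXACT upper bound on `dim Sel₃`.
Appended; decls above byte-identical; per pair; class X4 unchanged; nothing booked.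
-/

/-- **X4 ∩ {r_an = 0}, `p = 3` potentially good, `ρ̄_{E,3^n}` onto for all `n`, `3 ∤ ∏ c_ℓ · c_D`,
`ord₃ #Ш_an ≤ 4`: `BSD(E,3)` from Kato's upper half + TWO second-`3`-descent `NONEMPTY` witnesses —
`hcard`-FREE** (= `X4RankZero.bsdp_three_of_kato_of_casselsTate_of_two_nonempty` without
`#Ш[3] = 9`). Per pair; class X4 unchanged; nothing booked; cc-eng-4 GEN 11.
[cite: Kato2004Asterisque, Thm. 14.5 (3) (p. 236)] [cite: SilvermanAEC2009, Thm. X.4.14]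
[cite: Creutz2014, §1] [cite: Miller2011LMS, §1 and Def. 1.1] -/
theorem X4RankZero.bsdp_three_of_kato_of_casselsTate_of_two_nonempty'
    (hKato : Kato2004.rankZero_padicValNat_sha_le_of_additive_potGood_of_imageContainsSL2)
    (hGZK : rank_eq_analyticRank_of_analyticRank_le_one) (hmod : hasEntireLFunction_rat)
    (hCT : exists_casselsTate_pairing (K := ℚ))
    (hr : W.analyticRank = 0) (hX : ClassX4 W 3) (hpot : 0 ≤ padicValRat 3 W.j)
    (hsurj : ∀ n : ℕ, W.HasSurjectiveModNGaloisRep (3 ^ n : ℕ)) (htam : ¬ 3 ∣ W.tamagawaProduct)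
    {N : ℕ} [NeZero N] (D : ModularParametrizationData W N) (hc : ¬ (3 : ℤ) ∣ D.maninConstant)
    {c₁ c₂ d₁ d₂ : W.sha} (h1 : 3 • c₁ = 0) (h2 : 3 • c₂ = 0) (hc₁ : c₁ ≠ 0)
    (hind : c₂ ∉ AddSubgroup.zmultiples c₁) (hd₁ : 3 • d₁ = c₁) (hd₂ : 3 • d₂ = c₂)
    {q : ℚ} (hq : shaAn W = (q : ℂ)) (hv : padicValRat 3 q ≤ 4) : BSDp W 3 :=
  haveI : Fact (Nat.Prime 3) := ⟨Nat.prime_three⟩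
  X4RankZero.bsdp_of_missingLowerBoundAt_of_kato W 3 hKato hGZK hmod hr hX hpot hsurj htam D
    (by exact_mod_cast hc)
    (missingLowerBoundAt_of_casselsTate_of_two_divisible' W 3 hCT hGZK (by rw [hr]; exact zero_le_one)
      h1 h2 hc₁ hind hd₁ hd₂ hq hv)

/-- **The same with `ρ̄_{E,9}` onto, `hcard`-FREE** (tower surjectivity from level `9`) — the shape of
the `#Ш_an = 81` X4 window row `19215t1` (SURJ9). Per pair; nothing booked; cc-eng-4 GEN 11.
[cite: Kato2004Asterisque, Thm. 14.5 (3) (p. 236)] [cite: SilvermanAEC2009, Thm. X.4.14]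
[cite: Creutz2014, §1] [cite: Miller2011LMS, §1 and Def. 1.1] -/
theorem X4RankZero.bsdp_three_of_kato_of_surj9_of_casselsTate_of_two_nonempty'
    (hKato : Kato2004.rankZero_padicValNat_sha_le_of_additive_potGood_of_imageContainsSL2)
    (hGZK : rank_eq_analyticRank_of_analyticRank_le_one) (hmod : hasEntireLFunction_rat)
    (hCT : exists_casselsTate_pairing (K := ℚ))
    (hr : W.analyticRank = 0) (hX : ClassX4 W 3) (hpot : 0 ≤ padicValRat 3 W.j)
    (h9 : W.HasSurjectiveModNGaloisRep 9) (htam : ¬ 3 ∣ W.tamagawaProduct)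
    {N : ℕ} [NeZero N] (D : ModularParametrizationData W N) (hc : ¬ (3 : ℤ) ∣ D.maninConstant)
    {c₁ c₂ d₁ d₂ : W.sha} (h1 : 3 • c₁ = 0) (h2 : 3 • c₂ = 0) (hc₁ : c₁ ≠ 0)
    (hind : c₂ ∉ AddSubgroup.zmultiples c₁) (hd₁ : 3 • d₁ = c₁) (hd₂ : 3 • d₂ = c₂)
    {q : ℚ} (hq : shaAn W = (q : ℂ)) (hv : padicValRat 3 q ≤ 4) : BSDp W 3 :=
  X4RankZero.bsdp_three_of_kato_of_casselsTate_of_two_nonempty' W hKato hGZK hmod hCT hr hX hpot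
    (WeierstrassCurve.forall_hasSurjectiveModNGaloisRep_three_pow_of_nine W h9) htam D hc h1 h2 hc₁
    hind hd₁ hd₂ hq hv

/-- **The same in the census shape surj(3) ∧ ram(3), `hcard`-FREE** (tower surjectivity by
`hasSurjectiveModNGaloisRep_pow_of_hasMultiplicativeReductionAtPrime`). Per pair; nothing booked;
cc-eng-4 GEN 11. [cite: Kato2004Asterisque, Thm. 14.5 (3) (p. 236), (12.5.2) (p. 222)]
[cite: BurungaleSkinnerTianWan2024, Part II (sur), (ram) (p. 74)] [cite: SilvermanAEC2009, Thm. X.4.14]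
[cite: Creutz2014, §1] [cite: Miller2011LMS, §1 and Def. 1.1] -/
theorem X4RankZero.bsdp_three_of_kato_of_surj_of_ram_of_casselsTate_of_two_nonempty'
    (hKato : Kato2004.rankZero_padicValNat_sha_le_of_additive_potGood_of_imageContainsSL2)
    (hGZK : rank_eq_analyticRank_of_analyticRank_le_one) (hmod : hasEntireLFunction_rat)
    (hCT : exists_casselsTate_pairing (K := ℚ))
    (hr : W.analyticRank = 0) (hX : ClassX4 W 3) (hpot : 0 ≤ padicValRat 3 W.j) (hs : Surj W 3)
    (hram : Ram W 3) (htam : ¬ 3 ∣ W.tamagawaProduct)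
    {N : ℕ} [NeZero N] (D : ModularParametrizationData W N) (hc : ¬ (3 : ℤ) ∣ D.maninConstant)
    {c₁ c₂ d₁ d₂ : W.sha} (h1 : 3 • c₁ = 0) (h2 : 3 • c₂ = 0) (hc₁ : c₁ ≠ 0)
    (hind : c₂ ∉ AddSubgroup.zmultiples c₁) (hd₁ : 3 • d₁ = c₁) (hd₂ : 3 • d₂ = c₂)
    {q : ℚ} (hq : shaAn W = (q : ℂ)) (hv : padicValRat 3 q ≤ 4) : BSDp W 3 :=
  haveI : Fact (Nat.Prime 3) := ⟨Nat.prime_three⟩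
  X4RankZero.bsdp_three_of_kato_of_casselsTate_of_two_nonempty' W hKato hGZK hmod hCT hr hX hpot
    (hasSurjectiveModNGaloisRep_pow_of_hasMultiplicativeReductionAtPrime W 3 hs hram) htam D hc h1 h2
    hc₁ hind hd₁ hd₂ hq hv

end Summit.BirchSwinnertonDyer.Rank1Residual.SecondDescent

end
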